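import Literature.NumberTheory.Automorphic.GodementJacquetLocal
import Literature.NumberTheory.Automorphic.MatrixCoefficientsProofs
import Literature.NumberTheory.Automorphic.CompactSubgroupAveraging
import HarnessLib

/-!
# Non-vanishing of the local Godement–Jacquet zeta integrals at finite places (proved)

Trunk `AutomorphicAxiomatic` (G19), topic `NumberTheory/Automorphic`; proof file (theorems only)
on top of `GodementJacquetLocal` (the local zeta integrals `Z(Φ, s, f) =
∫_{GL_n(F)} Φ(x) f(x) |det x|^s dμG(x)` of Godement–Jacquet, LNM 260 (1972), §3, for a
non-archimedean local field `F`). Part of the bottom-up decomposition of the named fact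
`Literature.NumberTheory.Automorphic.godementJacquet_hasMeromorphicContinuation` (**lang.S21**; LNM 260, Thm. 13.8): the
Euler-factorisation ingredient `GodementJacquet1972_gjZeta_eulerFactorisation`
(`GodementJacquetZetaIntegrals`) needs, at each of the finitely many bad finite places `v ∈ S`,
local data whose zeta integral is *not identically zero*. This file **proves** the standard
choice (Godement–Jacquet (1972), §3, in the proof of Thm. 3.3: "the ideal spanned by the zeta
integrals contains the constants"; Jacquet, Corvallis (1979), Part 2, §1, proof of Prop. (1.2);
Gelbart (1975), §6, p. 83 for `n = 2`: "a finite sum of such quotients is a non-zero constant for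
a suitable choice of the data"):

* `exists_gjLocalZeta_eq_const`: for any representation `ρ` of `GL_n(F)` on a complex vector
  space, any **smooth** vector `v` (open stabiliser) and any linear form `φ`, there is a
  Schwartz–Bruhat function `Φ` on `M_n(F)` — the characteristic function of the compact open
  subgroup `B = Stab(v) ∩ GL_n(𝒪_F)`, viewed inside `M_n(F)` — and a constant `c > 0`
  (`c = μG(B)`) with `Z(Φ, s, f) = c · φ(v)` for **all** `s ∈ ℂ`, `f(g) = φ(ρ(g) v)` the
  coefficient (`ρ.matrixCoeff φ v`), the integral converging absolutely for every `s`: on `B` the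
  coefficient is constantly `φ(v)` and `|det x| = 1`.
* `exists_gjLocalZeta_ne_zero` (`φ(v) ≠ 0` gives a zeta integral vanishing nowhere),
  `exists_data_gjLocalZeta_eq_const` (a smooth representation on a non-zero space has data with
  `Z(Φ, s, f)` a non-zero constant) and `exists_coeff_gjLocalZeta_eq_const` (the same with a
  genuine coefficient `f(g) = ⟨ρ(g) v, ṽ⟩`, `ṽ ∈ Ṽ` in the **smooth contragredient**
  `ρ.contragredient`, the data of `HasGJLFactor` and of the printed theory).
* `exists_mem_contragredient_apply_ne_zero`: **the smooth contragredient separates points**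
  (non-degeneracy of `V × Ṽ → ℂ`; Bernstein–Zelevinsky (1976), §2.13; Bushnell–Henniart,
  §2.8–§2.10), for any smooth representation of a topological group with a compact open subgroup:
  average a linear form `ψ` with `ψ(x) ≠ 0` over the compact open subgroup `Stab(x) ∩ K₀`
  (Haar probability `subgroupHaar` of `CompactSubgroupAveraging`; the integrands
  `k ↦ ψ(ρ(k⁻¹) w)` are locally constant, `isLocallyConstant_matrixCoeff`).

Honest ingredients, proved here in Mathlib generality and of independent use:
`isOpenEmbedding_generalLinearGroup_val` (**`GL_m(F) ↪ M_m(F)` is an open embedding** for any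
Hausdorff topological field `F` with continuous inversion: the unit group of the topological
ring `M_m(F)` has the subspace topology — inversion `A ↦ (det A)⁻¹ adj A` is continuous on the
invertible locus — and open range `{det ≠ 0}`), `det_mem_of_forall_mem` (a determinant with
entries in a subring lies in it), `normAbs_det_eq_one_of_mem_glInt` (`|det k|_F = 1` on
`GL_n(𝒪_F)`), `t2Space_of_isValuativeTopology`.

Nothing here is in Mathlib: Mathlib has `IsOpenUnits` (`Topology/Algebra/IsOpenUnits.lean`) with
instances for groups, groups with zero and adic rings only, no matrix instance, and
`Units.isOpenEmbedding_val` only for complete normed rings; grep `GeneralLinearGroup` +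
`IsOpenEmbedding`: no hits.

## References

* R. Godement, H. Jacquet, *Zeta functions of simple algebras*, LNM 260 (1972), §3 (proof of
  Thm. 3.3) [GodementJacquet1972] (not held; the argument is the standard one restated in the two
  held sources below).
* H. Jacquet, *Principal `L`-functions of the linear group*, Proc. Sympos. Pure Math. 33 (1979),
  Part 2, §1, Prop. (1.2) [JacquetCorvallis1979].
* S. Gelbart, *Automorphic forms on adele groups*, Ann. of Math. Stud. 83 (1975), §6, p. 83
  (read) [Gelbart1975].
* I. N. Bernstein, A. V. Zelevinsky, *Representations of the group `GL(n, F)` where `F` is a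
  non-archimedean local field*, Russian Math. Surveys 31 (1976), §2.13 (the contragredient;
  `Ṽ` separates points) [BernsteinZelevinsky1976].
-/

set_option autoImplicit false

open scoped NNReal MatrixGroups
open Topology Matrix MeasureTheory ValuativeRel Literature.NumberTheory.GaloisRepresentations.IsNonarchimedeanLocalField

noncomputable section

namespace Literature.NumberTheory.Automorphic

/-! ### `GL_m(F) ↪ M_m(F)` is an open embedding -/

section OpenEmbedding

variable {m : Type*} [Fintype m] [DecidableEq m] {F : Type*} [Field F] [TopologicalSpace F]
  [IsTopologicalRing F] [ContinuousInv₀ F] [T1Space F]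

/-- Over a Hausdorff topological field with continuous inversion, the inclusion
`GL_m(F) ↪ M_m(F)` of the unit group of the matrix ring (with Mathlib's unit-group topology,
induced by `g ↦ (g, g⁻¹)`) is an **open embedding**: the two topologies on `GL_m(F)` agree
because `A ↦ A⁻¹ = (det A)⁻¹ • adj A` is continuous on the invertible locus (Mathlib
`Units.isEmbedding_val_mk'`, `Matrix.inv_def`), and the range `{A | det A ≠ 0}` is open
(Bourbaki, *General Topology*, III §6; Weil, *Basic Number Theory*, Ch. I). [folklore] -/
theorem isOpenEmbedding_generalLinearGroup_val :
    IsOpenEmbedding ((↑) : GL m F → Matrix m m F) := by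
  have hrange : Set.range ((↑) : GL m F → Matrix m m F) =
      (fun A : Matrix m m F => A.det) ⁻¹' {0}ᶜ := by
    ext A
    constructor
    · rintro ⟨u, rfl⟩
      exact (Matrix.isUnit_iff_isUnit_det _ |>.mp u.isUnit).ne_zero
    · intro hA
      exact ⟨(Matrix.isUnit_iff_isUnit_det A |>.mpr (isUnit_iff_ne_zero.mpr hA)).unit, rfl⟩
  refine ⟨Units.isEmbedding_val_mk' (f := fun A : Matrix m m F => A⁻¹) ?_ ?_, ?_⟩
  · intro A hA
    have hdet : A.det ≠ 0 := ((Matrix.isUnit_iff_isUnit_det A).mp hA).ne_zero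
    have h1 : ContinuousAt (fun B : Matrix m m F => B.det⁻¹ • B.adjugate) A :=
      ((continuous_id.matrix_det.continuousAt.inv₀ hdet).smul
        continuous_id.matrix_adjugate.continuousAt)
    refine (h1.congr ?_).continuousWithinAt
    filter_upwards [(continuous_id.matrix_det.continuousAt (x := A)).eventually_ne hdet] with B _
    rw [Matrix.inv_def, Ring.inverse_eq_inv]
  · intro u
    exact (Matrix.coe_units_inv u).symm
  · rw [hrange]
    exact (isClosed_singleton.preimage continuous_id.matrix_det).isOpen_compl

/-- The image in `M_m(F)` of an open subset of `GL_m(F)` is open. [folklore] -/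
theorem isOpen_image_generalLinearGroup_val {U : Set (GL m F)} (hU : IsOpen U) :
    IsOpen (((↑) : GL m F → Matrix m m F) '' U) :=
  isOpenEmbedding_generalLinearGroup_val.isOpenMap U hU

end OpenEmbedding

/-! ### Determinants of integral matrices -/

section Det

variable {m : Type*} [Fintype m] [DecidableEq m] {R : Type*} [CommRing R]

/-- The determinant of a matrix with entries in a subring lies in the subring (it is the
determinant of the corresponding matrix over the subring, Mathlib `RingHom.map_det`).
[folklore] -/
theorem det_mem_of_forall_mem {S : Subring R} {A : Matrix m m R} (h : ∀ i j, A i j ∈ S) :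
    A.det ∈ S := by
  let A' : Matrix m m S := Matrix.of fun i j => ⟨A i j, h i j⟩
  have hA : A = S.subtype.mapMatrix A' := by
    ext i j; rfl
  rw [hA, ← RingHom.map_det]
  exact (A'.det).2

end Det

/-! ### The local field: Hausdorffness and `|det| = 1` on `GL_n(𝒪_F)` -/

section LocalField

variable {n : ℕ} {F : Type*} [Field F] [ValuativeRel F] [TopologicalSpace F]
  [IsNonarchimedeanLocalField F]

omit [IsNonarchimedeanLocalField F] in
/-- A field with a valuative topology is Hausdorff (`0` is separated from `x ≠ 0` by the ball
`{v < v(x)}`; same argument as in `IsNonarchimedeanLocalField.isLocalField` of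
`GaloisRepresentations/LocalField`). A `theorem`, not an instance (Mathlib will eventually
provide it). [folklore] -/
theorem t2Space_of_isValuativeTopology [IsValuativeTopology F] : T2Space F := by
  apply IsTopologicalAddGroup.t2Space_of_zero_sep
  intro x hx
  refine ⟨{ z | valuation F z < valuation F x }, ?_, by simp⟩
  rw [IsValuativeTopology.mem_nhds_zero_iff]
  exact ⟨Units.mk0 (valuation F x) (by simpa using hx), subset_rfl⟩

/-- A non-archimedean local field is Hausdorff. [folklore] -/
theorem t2Space_of_isNonarchimedeanLocalField : T2Space F :=
  t2Space_of_isValuativeTopology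

/-- `|det k|_F = 1` for `k ∈ GL_n(𝒪_F)`: `det k` and `det k⁻¹` are integral
(`det_mem_of_forall_mem`, `mem_glInt_iff`) with product `1`, and `|·|_F ≤ 1` on `𝒪_F`
(`normAbs_le_one_iff`). Weil, *Basic Number Theory*, Ch. II §4 (the module is `1` on the
maximal compact subgroup). [folklore] -/
theorem normAbs_det_eq_one_of_mem_glInt {g : GL (Fin n) F} (hg : g ∈ glInt n F) :
    normAbs F ((Matrix.GeneralLinearGroup.det g : Fˣ) : F) = 1 := by
  rw [mem_glInt_iff] at hg
  have h1 : normAbs F ((Matrix.GeneralLinearGroup.det g : Fˣ) : F) ≤ 1 :=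
    normAbs_le_one_iff.mpr (det_mem_of_forall_mem (S := 𝒪[F]) hg.1)
  have h2 : normAbs F ((Matrix.GeneralLinearGroup.det g⁻¹ : Fˣ) : F) ≤ 1 :=
    normAbs_le_one_iff.mpr (det_mem_of_forall_mem (S := 𝒪[F]) hg.2)
  have h12 : normAbs F ((Matrix.GeneralLinearGroup.det g : Fˣ) : F) *
      normAbs F ((Matrix.GeneralLinearGroup.det g⁻¹ : Fˣ) : F) = 1 := by
    rw [← map_mul, ← Units.val_mul, ← map_mul, mul_inv_cancel, map_one, Units.val_one, map_one]
  refine le_antisymm h1 ?_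
  calc (1 : ℝ≥0) = _ := h12.symm
    _ ≤ normAbs F ((Matrix.GeneralLinearGroup.det g : Fˣ) : F) * 1 := by gcongr
    _ = _ := mul_one _

/-- The integrand of the local zeta integral at `|det x|_F = 1`: `Φ(x) f(x)` (no dependence on
`s`). [folklore] -/
theorem gjLocalIntegrand_of_mem_glInt (Φ : Matrix (Fin n) (Fin n) F → ℂ) (f : GL (Fin n) F → ℂ)
    (s : ℂ) {x : GL (Fin n) F} (hx : x ∈ glInt n F) :
    gjLocalIntegrand Φ f s x = Φ x * f x := by
  rw [gjLocalIntegrand, normAbs_det_eq_one_of_mem_glInt hx]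
  simp

end LocalField

/-! ### The smooth contragredient separates points -/

section Separation

variable {G : Type*} [Group G] [TopologicalSpace G] [IsTopologicalGroup G]
  {V : Type*} [AddCommGroup V] [Module ℂ V]

/-- **The smooth contragredient separates points** (non-degeneracy of the canonical pairing
`V × Ṽ → ℂ`; Bernstein–Zelevinsky (1976), §2.13; Bushnell–Henniart, *The local Langlands
conjecture for `GL(2)`*, §2.8–§2.10). Let `ρ` be a smooth representation of a topological group
`G` possessing a compact open subgroup `K₀` (e.g. `GL_n(𝒪_F) ≤ GL_n(F)`), and `x ≠ 0`. Then some
`λ ∈ Ṽ = (V^*)^∞` (`ρ.contragredient`) has `λ(x) ≠ 0`: take a linear form `ψ` with `ψ(x) ≠ 0`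
(Mathlib `Module.forall_dual_apply_eq_zero_iff`) and average it over the compact open subgroup
`K = Stab(x) ∩ K₀`, `λ(w) = ∫_K ψ(ρ(k⁻¹) w) dk` (Haar probability measure `subgroupHaar`; each
integrand is locally constant in `k`, `isLocallyConstant_matrixCoeff`, hence integrable): `λ` is
linear, `K`-invariant (left invariance of `dk`), hence smooth, and `λ(x) = ψ(x)`. [folklore] -/
theorem exists_mem_contragredient_apply_ne_zero (ρ : Representation ℂ G V) (hρ : ρ.IsSmooth)
    {K₀ : Subgroup G} (hK₀o : IsOpen (K₀ : Set G)) (hK₀c : IsCompact (K₀ : Set G))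
    {x : V} (hx : x ≠ 0) :
    ∃ lam ∈ ρ.contragredient, lam x ≠ 0 := by
  borelize G
  -- a linear form non-zero at `x`
  obtain ⟨ψ, hψ⟩ : ∃ ψ : Module.Dual ℂ V, ψ x ≠ 0 := by
    by_contra h
    push Not at h
    exact hx ((Module.forall_dual_apply_eq_zero_iff ℂ x).mp h)
  -- the compact open subgroup `K = Stab(x) ∩ K₀`
  set K : Subgroup G := ρ.stabilizerSubgroup x ⊓ K₀ with hKdef
  have hKo : IsOpen (K : Set G) := (hρ x).inter hK₀o
  have hKc : IsCompact (K : Set G) :=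
    hK₀c.of_isClosed_subset (Subgroup.isClosed_of_isOpen K hKo)
      (fun g hg => (Subgroup.mem_inf.mp hg).2)
  haveI : CompactSpace K := isCompact_iff_compactSpace.mp hKc
  -- the integrands `k ↦ ψ(ρ(k⁻¹) w)` are locally constant, hence integrable on `K`
  have hF : ∀ w : V, Continuous fun k : K => ρ.matrixCoeff ψ w ((k : G)⁻¹) := fun w =>
    ((ρ.isLocallyConstant_matrixCoeff ψ (hρ w)).comp_continuous
      continuous_subtype_val.inv).continuous
  have hFi : ∀ w : V, Integrable (fun k : K => ρ.matrixCoeff ψ w ((k : G)⁻¹))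
      (subgroupHaar K hKc) := fun w =>
    (hF w).integrable_of_hasCompactSupport (HasCompactSupport.of_compactSpace _)
  -- the averaged form `λ(w) = ∫_K ψ(ρ(k⁻¹) w) dk`
  let lam : Module.Dual ℂ V :=
    { toFun := fun w => ∫ k : K, ρ.matrixCoeff ψ w ((k : G)⁻¹) ∂(subgroupHaar K hKc)
      map_add' := fun w w' => by
        simp only [Representation.matrixCoeff, map_add]
        exact integral_add (hFi w) (hFi w')
      map_smul' := fun c w => by
        simp only [Representation.matrixCoeff, map_smul, smul_eq_mul, RingHom.id_apply]
        exact integral_const_mul c _ }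
  have hlam_apply : ∀ w, lam w = ∫ k : K, ψ (ρ ((k : G)⁻¹) w) ∂(subgroupHaar K hKc) :=
    fun w => rfl
  -- `λ` is `K`-invariant
  have hinv : ∀ g ∈ K, ∀ w, lam (ρ g w) = lam w := by
    intro g hg w
    rw [hlam_apply, hlam_apply]
    have := integral_mul_left_eq_self (μ := subgroupHaar K hKc)
      (fun k : K => ψ (ρ ((k : G)⁻¹) w)) (⟨g, hg⟩⁻¹ : K)
    rw [← this]
    congr 1 with k
    simp [map_mul]
  refine ⟨lam, ?_, ?_⟩
  · -- smooth: the dual stabiliser contains the open subgroup `K`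
    rw [Representation.mem_contragredient]
    refine ρ.dual.isSmoothVector_of_le hKo fun g hg => ?_
    rw [Representation.mem_stabilizerSubgroup]
    ext w
    rw [Representation.dual_apply, Module.Dual.transpose_apply, LinearMap.comp_apply]
    exact hinv g⁻¹ (K.inv_mem hg) w
  · -- `λ(x) = ψ(x) ≠ 0`
    rw [hlam_apply]
    have : ∀ k : K, ψ (ρ ((k : G)⁻¹) x) = ψ x := fun k => by
      rw [(ρ.mem_stabilizerSubgroup x _).mp (Subgroup.mem_inf.mp (K.inv_mem k.2)).1]
    simp_rw [this, integral_const]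
    rw [show (subgroupHaar K hKc).real Set.univ = 1 by simp, one_smul]
    exact hψ

end Separation

/-! ### Local non-vanishing (Godement–Jacquet (1972), §3) -/

section Nonvanishing

variable {n : ℕ} {F : Type*} [Field F] [ValuativeRel F] [TopologicalSpace F]
  [IsNonarchimedeanLocalField F]
variable {V : Type*} [AddCommGroup V] [Module ℂ V]

/-- **Local zeta integrals with constant non-zero value** (Godement–Jacquet (1972), §3, proof of
Thm. 3.3; Jacquet (1979), proof of Prop. (1.2); Gelbart (1975), §6, p. 83). Let `ρ` be a
representation of `GL_n(F)` on a complex vector space, `v` a smooth vector (open stabiliser),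
`φ` a linear form and `f(g) = φ(ρ(g) v)` the coefficient (`ρ.matrixCoeff φ v`); let `μG` be a
Haar measure on `GL_n(F)`. Put `B = Stab(v) ∩ GL_n(𝒪_F)`, a compact open subgroup, and let
`Φ = 1_B` be the characteristic function of its (compact open) image in `M_n(F)`, a
Schwartz–Bruhat function. Then for **every** `s ∈ ℂ` the integral `Z(Φ, s, f)` converges
absolutely and `Z(Φ, s, f) = μG(B) · φ(v)` with `μG(B) > 0`: on `B`, `f ≡ φ(v)` and
`|det| ≡ 1`. In particular the zeta integrals of a coefficient with `f(1) = φ(v) ≠ 0` are not all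
identically zero — the step "the ideal `I(π)` contains the constants" of the printed proof.
[cite: GodementJacquet1972, §3 (proof of Thm. 3.3)] -/
theorem exists_gjLocalZeta_eq_const [MeasurableSpace (GL (Fin n) F)] [BorelSpace (GL (Fin n) F)]
    (μG : Measure (GL (Fin n) F)) [μG.IsHaarMeasure]
    (ρ : Representation ℂ (GL (Fin n) F) V) {v : V} (hv : ρ.IsSmoothVector v)
    (φ : Module.Dual ℂ V) :
    ∃ Φ ∈ SchwartzBruhat (Matrix (Fin n) (Fin n) F), ∃ c : ℝ, 0 < c ∧
      ∀ s : ℂ, Integrable (gjLocalIntegrand Φ (ρ.matrixCoeff φ v) s) μG ∧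
        gjLocalZeta μG Φ (ρ.matrixCoeff φ v) s = (c : ℂ) * φ v := by
  haveI : T2Space F := t2Space_of_isNonarchimedeanLocalField
  -- the compact open subgroup `B = Stab(v) ∩ GL_n(𝒪_F)`
  set B : Subgroup (GL (Fin n) F) := ρ.stabilizerSubgroup v ⊓ glInt n F with hB
  have hBo : IsOpen (B : Set (GL (Fin n) F)) := hv.inter (isOpen_glInt n F)
  have hBc : IsCompact (B : Set (GL (Fin n) F)) :=
    (isCompact_glInt n F).of_isClosed_subset (Subgroup.isClosed_of_isOpen B hBo)
      (fun x hx => (Subgroup.mem_inf.mp hx).2)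
  -- its compact open image `C ⊆ M_n(F)`
  set C : Set (Matrix (Fin n) (Fin n) F) :=
    ((↑) : GL (Fin n) F → Matrix (Fin n) (Fin n) F) '' (B : Set (GL (Fin n) F)) with hCdef
  have hCo : IsOpen C := isOpen_image_generalLinearGroup_val hBo
  have hCc : IsCompact C := hBc.image Units.continuous_val
  have hCcl : IsClosed C := hCc.isClosed
  refine ⟨C.indicator 1, ?_, μG.real (B : Set (GL (Fin n) F)), ?_, ?_⟩
  · -- `1_C` is Schwartz–Bruhat: locally constant (C clopen) with compact support
    rw [mem_schwartzBruhat_iff]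
    refine ⟨?_, ?_⟩
    · rw [IsLocallyConstant.iff_exists_open]
      intro x
      by_cases hx : x ∈ C
      · exact ⟨C, hCo, hx, fun x' hx' => by
          rw [Set.indicator_of_mem hx', Set.indicator_of_mem hx]; rfl⟩
      · exact ⟨Cᶜ, hCcl.isOpen_compl, hx, fun x' hx' => by
          rw [Set.indicator_of_notMem hx', Set.indicator_of_notMem hx]⟩
    · exact HasCompactSupport.intro' hCc hCcl fun x hx => Set.indicator_of_notMem hx _
  · -- `μG(B) > 0`: open non-empty, and finite (compact)
    exact ENNReal.toReal_pos (hBo.measure_pos μG ⟨1, B.one_mem⟩).ne' hBc.measure_lt_top.ne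
  · intro s
    -- the integrand is `1_B · φ(v)`
    have hint : gjLocalIntegrand (C.indicator 1) (ρ.matrixCoeff φ v) s =
        (B : Set (GL (Fin n) F)).indicator (fun _ => φ v) := by
      ext x
      by_cases hx : x ∈ (B : Set (GL (Fin n) F))
      · have hx' := Subgroup.mem_inf.mp hx
        have hxC : (x : Matrix (Fin n) (Fin n) F) ∈ C := Set.mem_image_of_mem _ hx
        have hxv : ρ x v = v := (ρ.mem_stabilizerSubgroup v x).mp hx'.1
        rw [gjLocalIntegrand_of_mem_glInt _ _ s hx'.2]
        simp [Set.indicator_of_mem hxC, Set.indicator_of_mem hx, Representation.matrixCoeff, hxv]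
      · have hxC : (x : Matrix (Fin n) (Fin n) F) ∉ C := fun h =>
          hx (Units.val_injective.mem_set_image.mp h)
        simp [gjLocalIntegrand, Set.indicator_of_notMem hxC, Set.indicator_of_notMem hx]
    have hBm : MeasurableSet (B : Set (GL (Fin n) F)) := hBo.measurableSet
    refine ⟨?_, ?_⟩
    · rw [hint, integrable_indicator_iff hBm]
      exact integrableOn_const hBc.measure_lt_top.ne
    · rw [gjLocalZeta, hint, integral_indicator_const _ hBm, Complex.real_smul]

/-- **A coefficient with `f(1) ≠ 0` has a nowhere-vanishing zeta integral** (Godement–Jacquet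
(1972), §3; Jacquet (1979), proof of Prop. (1.2)): if `v` is smooth and `φ(v) ≠ 0` there is a
Schwartz–Bruhat `Φ` on `M_n(F)` with `Z(Φ, s, φ(ρ(·) v))` absolutely convergent and `≠ 0` for
every `s ∈ ℂ`. This is the finite-place half of the "local non-vanishing" used in the Euler
factorisation step of LNM 260, Thm. 13.8 (`GodementJacquet1972_gjZeta_eulerFactorisation` of
`GodementJacquetZetaIntegrals`). [cite: GodementJacquet1972, §3 (proof of Thm. 3.3)] -/
theorem exists_gjLocalZeta_ne_zero [MeasurableSpace (GL (Fin n) F)] [BorelSpace (GL (Fin n) F)]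
    (μG : Measure (GL (Fin n) F)) [μG.IsHaarMeasure]
    (ρ : Representation ℂ (GL (Fin n) F) V) {v : V} (hv : ρ.IsSmoothVector v)
    {φ : Module.Dual ℂ V} (hφv : φ v ≠ 0) :
    ∃ Φ ∈ SchwartzBruhat (Matrix (Fin n) (Fin n) F),
      ∀ s : ℂ, Integrable (gjLocalIntegrand Φ (ρ.matrixCoeff φ v) s) μG ∧
        gjLocalZeta μG Φ (ρ.matrixCoeff φ v) s ≠ 0 := by
  obtain ⟨Φ, hΦ, c, hc, h⟩ := exists_gjLocalZeta_eq_const μG ρ hv φ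
  refine ⟨Φ, hΦ, fun s => ⟨(h s).1, ?_⟩⟩
  rw [(h s).2]
  exact mul_ne_zero (Complex.ofReal_ne_zero.mpr hc.ne') hφv

/-- **The zeta integrals of a smooth representation on a non-zero space are not all zero; one of
them is a non-zero constant** (Godement–Jacquet (1972), §3: `I(π) ∋ 1`): for `ρ` smooth on
`V ≠ 0` there are `v ∈ V`, a linear form `φ` and `Φ ∈ 𝒮(M_n(F))` with `Z(Φ, s, φ(ρ(·) v)) = c`,
`c ≠ 0`, for all `s` (pick `v ≠ 0`, `φ` with `φ(v) ≠ 0` — linear forms separate points of a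
vector space, Mathlib `Module.forall_dual_apply_eq_zero_iff` — and apply
`exists_gjLocalZeta_eq_const`). [cite: GodementJacquet1972, §3 (proof of Thm. 3.3)] -/
theorem exists_data_gjLocalZeta_eq_const [MeasurableSpace (GL (Fin n) F)]
    [BorelSpace (GL (Fin n) F)] (μG : Measure (GL (Fin n) F)) [μG.IsHaarMeasure]
    (ρ : Representation ℂ (GL (Fin n) F) V) (hρ : ρ.IsSmooth) [Nontrivial V] :
    ∃ (v : V) (φ : Module.Dual ℂ V), ∃ Φ ∈ SchwartzBruhat (Matrix (Fin n) (Fin n) F),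
      ∃ c : ℂ, c ≠ 0 ∧ ∀ s : ℂ, Integrable (gjLocalIntegrand Φ (ρ.matrixCoeff φ v) s) μG ∧
        gjLocalZeta μG Φ (ρ.matrixCoeff φ v) s = c := by
  obtain ⟨v, hv0⟩ := exists_ne (0 : V)
  obtain ⟨φ, hφ⟩ : ∃ φ : Module.Dual ℂ V, φ v ≠ 0 := by
    by_contra h
    push Not at h
    exact hv0 ((Module.forall_dual_apply_eq_zero_iff ℂ v).mp h)
  obtain ⟨Φ, hΦ, c, hc, h⟩ := exists_gjLocalZeta_eq_const μG ρ (hρ v) φ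
  exact ⟨v, φ, Φ, hΦ, (c : ℂ) * φ v,
    mul_ne_zero (Complex.ofReal_ne_zero.mpr hc.ne') hφ, fun s => h s⟩

/-- **Godement–Jacquet's step `1 ∈ I(π)` with genuine coefficients**: for a smooth
representation `ρ` of `GL_n(F)` on `V ≠ 0` there are `v ∈ V`, `ṽ ∈ Ṽ` (the smooth
contragredient `ρ.contragredient`) and `Φ ∈ 𝒮(M_n(F))` such that the zeta integral of the
coefficient `f(g) = ⟨ρ(g) v, ṽ⟩ = ρ.matrixCoeff ṽ v g` is a **non-zero constant**:
`Z(Φ, s, f) = c ≠ 0` for all `s ∈ ℂ`, absolutely convergent (Godement–Jacquet (1972), §3, proof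
of Thm. 3.3; Jacquet (1979), proof of Prop. (1.2); Gelbart (1975), p. 83). Combines
`exists_mem_contragredient_apply_ne_zero` (with `K₀ = GL_n(𝒪_F)`, compact open:
`isCompact_glInt`, `isOpen_glInt`) and `exists_gjLocalZeta_eq_const`. This is the local
non-vanishing at the finite places `v ∈ S` required by the Euler-factorisation step of LNM 260,
Thm. 13.8. [cite: GodementJacquet1972, §3 (proof of Thm. 3.3)] -/
theorem exists_coeff_gjLocalZeta_eq_const [MeasurableSpace (GL (Fin n) F)]
    [BorelSpace (GL (Fin n) F)] (μG : Measure (GL (Fin n) F)) [μG.IsHaarMeasure]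
    (ρ : Representation ℂ (GL (Fin n) F) V) (hρ : ρ.IsSmooth) [Nontrivial V] :
    ∃ (v : V), ∃ lam ∈ ρ.contragredient, ∃ Φ ∈ SchwartzBruhat (Matrix (Fin n) (Fin n) F),
      ∃ c : ℂ, c ≠ 0 ∧ ∀ s : ℂ, Integrable (gjLocalIntegrand Φ (ρ.matrixCoeff lam v) s) μG ∧
        gjLocalZeta μG Φ (ρ.matrixCoeff lam v) s = c := by
  obtain ⟨v, hv0⟩ := exists_ne (0 : V)
  obtain ⟨lam, hlam, hlamv⟩ :=
    exists_mem_contragredient_apply_ne_zero ρ hρ (isOpen_glInt n F) (isCompact_glInt n F) hv0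
  obtain ⟨Φ, hΦ, c, hc, h⟩ := exists_gjLocalZeta_eq_const μG ρ (hρ v) lam
  exact ⟨v, lam, hlam, Φ, hΦ, (c : ℂ) * lam v,
    mul_ne_zero (Complex.ofReal_ne_zero.mpr hc.ne') hlamv, fun s => h s⟩

end Nonvanishing

end Literature.NumberTheory.Automorphic
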